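import Literature.RingTheory.HilbertSamuel.NormalFlatnessHilbertFunction
import Literature.RingTheory.HilbertSamuel.RegularCriterion
import Literature.RingTheory.HilbertSamuel.MinimalPrimesCodim
import Literature.AlgebraicGeometry.Resolution.OrderGenericAlongPrime
import Literature.AlgebraicGeometry.Resolution.RegularLocalRingsProofs
import HarnessLib

/-!
# Normal flatness along a regular centre whose generic point is a regular point forces regularity

Topic: `Literature/RingTheory/HilbertSamuel`. A consequence of Bennett's numerical criterion for
normal flatness (CJS 2020 Thm. 3.3 / HIO Cor. (21.12), in the tree
`hilbertFun_eq_hilbertSamuelFun_of_isNormallyFlat`) and of CJS Lemma 2.23 (the Hilbert function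
of a regular local ring, `hilbertFun_eq_iterPSum_Phi_of_isRegularLocalRing`): let `(R, 𝔪)` be a
Noetherian local ring and `𝔭` a prime ideal with `R/𝔭` regular (a *regular centre* `V(𝔭)` through
the closed point) along which `R` is normally flat (`Ideal.IsNormallyFlat`, CJS Def. 3.1 (1)). If the
local ring `R_𝔭` at the generic point of the centre is regular, then `R` itself is regular
(`isRegularLocalRing_of_isNormallyFlat_of_isRegularLocalRing_localization`): indeed
`H^{(0)}[R] = H^{(r)}[R_𝔭] = Φ^{(r + h)}` with `r = dim R/𝔭`, `h = dim R_𝔭 = ht 𝔭`, so the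
embedding dimension `H^{(0)}[R](1) = r + h ≤ dim R` (`dim R/𝔭 + ht 𝔭 ≤ dim R`), and
`emb dim ≤ dim` is regularity. Contrapositive, the form used by resolution algorithms
("a Hironaka-permissible centre through a singular point lies in the singular locus"): if `R` is
NOT regular, a normally flat regular centre `𝔭` has `R_𝔭` singular; and if moreover `R` has an
ISOLATED singularity (every non-maximal prime localises to a regular ring), the only normally flat
regular centre is the closed point (`eq_maximalIdeal_of_isNormallyFlat_of_isolated`). Mathlib-only
statements over the tree's Hilbert–Samuel library; all PROVED. [folklore]

## Sources

* V. Cossart, U. Jannsen, S. Saito, LNM 2270 (2020), Def. 3.1, Lemma 2.23, Thm. 3.3.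
  [CossartJannsenSaito2020]
* M. Herrmann, S. Ikeda, U. Orbanz, *Equimultiplicity and Blowing up* (1988), Cor. (21.12),
  Thm. (22.24). [HerrmannIkedaOrbanz1988]
* B. M. Bennett, *On the characteristic functions of a local ring*, Ann. of Math. 91 (1970), Thm. (3).
-/

noncomputable section

open IsLocalRing

namespace Literature.RingTheory.HilbertSamuel

universe u

variable {R : Type u} [CommRing R] [IsLocalRing R] [IsNoetherianRing R]

/-- **Normal flatness along a regular centre with regular generic point forces regularity.** For a
Noetherian local ring `R` and a prime `𝔭` with `R/𝔭` regular, `R` normally flat along `𝔭` and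
`R_𝔭` regular: `R` is regular. (Bennett: `H^{(0)}[R] = H^{(dim R/𝔭)}[R_𝔭] = Φ^{(dim R/𝔭 + ht 𝔭)}`,
whence `emb dim R = dim R/𝔭 + ht 𝔭 ≤ dim R`.)
[cite: CossartJannsenSaito2020, Thm. 3.3 and Lemma 2.23] [folklore] -/
theorem isRegularLocalRing_of_isNormallyFlat_of_isRegularLocalRing_localization (𝔭 : Ideal R)
    [𝔭.IsPrime] [IsRegularLocalRing (R ⧸ 𝔭)] (hNF : 𝔭.IsNormallyFlat)
    [IsRegularLocalRing (Localization.AtPrime 𝔭)] : IsRegularLocalRing R := by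
  -- the three dimensions, as natural numbers
  obtain ⟨d, hd⟩ : ∃ d : ℕ, ringKrullDim R = d :=
    exists_nat_eq_of_ne_bot_of_ne_top ringKrullDim_ne_bot ringKrullDim_ne_top
  obtain ⟨r, hr⟩ : ∃ r : ℕ, ringKrullDim (R ⧸ 𝔭) = r :=
    exists_nat_eq_of_ne_bot_of_ne_top ringKrullDim_ne_bot ringKrullDim_ne_top
  obtain ⟨h, hh⟩ : ∃ h : ℕ, ringKrullDim (Localization.AtPrime 𝔭) = h :=
    exists_nat_eq_of_ne_bot_of_ne_top ringKrullDim_ne_bot ringKrullDim_ne_top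
  -- Bennett + the Hilbert function of the regular ring `R_𝔭`
  have hH : hilbertFun R = iterPSum (r + h) Phi := by
    rw [hilbertFun_eq_hilbertSamuelFun_of_isNormallyFlat 𝔭 (Localization.AtPrime 𝔭) hr hNF,
      hilbertSamuelFun_of_isRegularLocalRing (Localization.AtPrime 𝔭) hh r]
  -- `dim R/𝔭 + ht 𝔭 ≤ dim R`
  have hht : 𝔭.height = h := by
    have := IsLocalization.AtPrime.ringKrullDim_eq_height 𝔭 (Localization.AtPrime 𝔭)
    rw [hh] at this
    exact_mod_cast this.symm
  have hle : r + h ≤ d := by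
    have := Literature.AlgebraicGeometry.Resolution.ringKrullDim_quotient_add_natCast_le_of_height_eq
      𝔭 hht
    rw [hr, hd] at this
    exact_mod_cast this
  -- `emb dim R = H^{(0)}[R](1) = r + h ≤ dim R`
  refine isRegularLocalRing_of_hilbertFun_one_le R hd ?_
  rw [hH, iterPSum_Phi_one]
  exact hle

/-- **A normally flat regular centre through a singular point has singular generic point**
(contrapositive of the previous theorem): if `R` is not regular, `R/𝔭` is regular and `R` is
normally flat along `𝔭`, then `R_𝔭` is not regular. [cite: CossartJannsenSaito2020, Thm. 3.3] [folklore] -/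
theorem not_isRegularLocalRing_localization_of_isNormallyFlat (hR : ¬ IsRegularLocalRing R)
    (𝔭 : Ideal R) [𝔭.IsPrime] [IsRegularLocalRing (R ⧸ 𝔭)] (hNF : 𝔭.IsNormallyFlat) :
    ¬ IsRegularLocalRing (Localization.AtPrime 𝔭) := fun _ =>
  hR (isRegularLocalRing_of_isNormallyFlat_of_isRegularLocalRing_localization 𝔭 hNF)

/-- **At an isolated singular point the only normally flat regular centre is the closed point.**
Let `R` be a Noetherian local ring which is NOT regular but whose localisations at all non-maximal
primes are regular (isolated singularity). If `𝔭` is an ideal with `R/𝔭` a regular local ring and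
`R` normally flat along `𝔭`, then `𝔭 = 𝔪`. [cite: CossartJannsenSaito2020, Thm. 3.3] [folklore] -/
theorem eq_maximalIdeal_of_isNormallyFlat_of_isolated (hR : ¬ IsRegularLocalRing R)
    (hisol : ∀ (P : Ideal R) [P.IsPrime], (∃ Q : Ideal R, Q.IsPrime ∧ P < Q) →
      IsRegularLocalRing (Localization.AtPrime P))
    (𝔭 : Ideal R) [IsRegularLocalRing (R ⧸ 𝔭)] (hNF : 𝔭.IsNormallyFlat) :
    𝔭 = maximalIdeal R := by
  haveI : IsDomain (R ⧸ 𝔭) := Literature.AlgebraicGeometry.Resolution.isDomain_of_isRegularLocalRing (R ⧸ 𝔭)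
  haveI : 𝔭.IsPrime := (Ideal.Quotient.isDomain_iff_prime 𝔭).mp inferInstance
  by_contra hne
  have hlt : 𝔭 < maximalIdeal R :=
    lt_of_le_of_ne (IsLocalRing.le_maximalIdeal (Ideal.IsPrime.ne_top inferInstance)) hne
  haveI := hisol 𝔭 ⟨maximalIdeal R, inferInstance, hlt⟩
  exact not_isRegularLocalRing_localization_of_isNormallyFlat hR 𝔭 hNF this

/-- The same with the centre given as a permissible one in the sense of CJS Def. 3.1 (2)
(`Ideal.IsPermissible`: regular, normally flat, in no minimal prime). [cite: CossartJannsenSaito2020, Def. 3.1 (2)] [folklore] -/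
theorem eq_maximalIdeal_of_isPermissible_of_isolated (hR : ¬ IsRegularLocalRing R)
    (hisol : ∀ (P : Ideal R) [P.IsPrime], (∃ Q : Ideal R, Q.IsPrime ∧ P < Q) →
      IsRegularLocalRing (Localization.AtPrime P))
    {𝔭 : Ideal R} (h𝔭 : 𝔭.IsPermissible) : 𝔭 = maximalIdeal R :=
  haveI := h𝔭.isRegularLocalRing
  eq_maximalIdeal_of_isNormallyFlat_of_isolated hR hisol 𝔭 h𝔭.isNormallyFlat

end Literature.RingTheory.HilbertSamuel

end
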